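import Mathlib

/-!
# Radicals of principal ideals: `√⟨f⟩ = ⟨f_red⟩` (Cox–Little–O'Shea, Ch. 4 §2, Prop. 9 – Def. 10)

[cite: CoxLittleOShea2007, Ch.4 §2 Prop. 9, Def. 10 (pp. 180–182 of the 3rd ed.; §2 "Hilbert's
Nullstellensatz … Radical Ideals")]

Cox–Little–O'Shea, *Ideals, Varieties, and Algorithms* (3rd ed., Springer UTM 2007), Chapter 4
§2, after the Nullstellensatz (Thms. 6, 7 — Mathlib
`MvPolynomial.vanishingIdeal_zeroLocus_eq_radical`) and the radical-membership test (Prop. 8 —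
anchor `IdealQuotientSaturation.lean`), computes the radical of a *principal* ideal:

* **Proposition 9.** If `f = c · f₁^{a₁} ⋯ f_r^{a_r}` is the factorisation of `f ∈ k[x₁,…,xₙ]`
  into a constant and powers of distinct irreducibles, then `√⟨f⟩ = ⟨f₁ f₂ ⋯ f_r⟩`
  (`radical_span_singleton_unit_mul_prod_pow`, stated for pairwise non-associated prime elements
  of any commutative ring; and, in a normalised factorial domain, with Mathlib's
  `UniqueFactorizationMonoid.radical f = ∏ p ∈ primeFactors f, p` playing `f₁ ⋯ f_r`:
  `radical_span_singleton_eq_span_radical`, `mem_radical_span_singleton_iff_radical_dvd` —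
  `g ∈ √⟨f⟩ ↔ f_red ∣ g`, which is the content of the book's proof).
* **Definition 10** (the *reduction* `f_red`: `⟨f_red⟩ = √⟨f⟩`, "unique up to a constant factor";
  `f` is *reduced* / *square-free* when `f_red = f`): existence and uniqueness
  (`exists_radical_span_singleton_eq_span`, `radical_span_singleton_eq_span_singleton_iff`,
  `mvPolynomial_exists_reduction`, `mvPolynomial_reduction_eq_C_mul` — in `k[x₁,…,xₙ]` the
  ambiguity is exactly a non-zero constant of `k`), and "reduced ⟺ square-free ⟺ `⟨f⟩` radical"
  (`span_singleton_isRadical_iff_squarefree`, `associated_radical_iff_squarefree`).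

Definition 11 (gcd) and **Proposition 12** (`f_red = f / gcd(f, ∂f/∂x₁, …, ∂f/∂xₙ)` when
`ℚ ⊆ k`), with the book's proof and Exercise 13, are formalised in the sibling file
`Literature/RingTheory/MvPolynomial/PrincipalIdealRadicalFormula.lean`
(`radical_span_singleton_eq_span_div_gcd_pderiv`, `exists_gcd_pderiv`,
`associated_gcd_pderiv_prod_pow_sub_one`, `radical_formula_fails_charTwo`, and the univariate
Ch. 1 §5 Ex. 14–15 `√⟨f⟩ = ⟨f / gcd(f, f')⟩`), not here; Mathlib has the univariate ingredient
`Polynomial.divRadical_dvd_derivative`.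

Mathlib searched (pin of this tree): `UniqueFactorizationMonoid.radical`, `primeFactors`,
`radical_dvd_self`, `squarefree_radical`, `radical_associated`, `exists_dvd_radical_self_pow`,
`exists_dvd_pow_iff_radical_dvd` (`RingTheory/Radical/Basic.lean`, whose module docstring lists
"`Ideal.radical (Ideal.span {a}) = Ideal.span {radical a}`" as a TODO — it is
`radical_span_singleton_eq_span_radical` below), `isRadical_iff_span_singleton`,
`isRadical_iff_squarefree_or_zero`, `Ideal.span_singleton_eq_span_singleton`,
`MvPolynomial.isUnit_iff_eq_C_of_isReduced`, `MvPolynomial.uniqueFactorizationMonoid`,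
`UniqueFactorizationMonoid.strongNormalizationMonoid`, `Prime.exists_mem_finset_dvd`. In this
tree, `Literature.AlgebraicGeometry.Resolution` has the neighbouring folklore
`Ideal.radical_span_singleton_prod_eq` (a product of pairwise non-associated primes generates a
radical ideal) and `exists_radical_span_singleton_eq_span_prod`; neither is imported (heavy import
chains) and neither states Prop. 9 / Def. 10.
-/

namespace Literature.RingTheory.UniqueFactorizationDomain.PrincipalIdealRadical

open UniqueFactorizationMonoid Ideal

/-! ## Proposition 9 for a given factorisation (prime elements of any commutative ring) -/

section CommRing

variable {R : Type*} [CommRing R]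

/-- A product of pairwise non-associated primes each dividing `x` divides `x`. [folklore] -/
private theorem prod_dvd_of_pairwise_not_dvd {ι : Type*} (s : Finset ι) (f : ι → R)
    (hf : ∀ i ∈ s, Prime (f i)) (hna : ∀ i ∈ s, ∀ j ∈ s, i ≠ j → ¬ f i ∣ f j) {x : R}
    (hx : ∀ i ∈ s, f i ∣ x) : (∏ i ∈ s, f i) ∣ x := by
  classical
  induction s using Finset.induction_on generalizing x with
  | empty => simp
  | insert a s ha ih =>
    rw [Finset.prod_insert ha]
    have hfa : Prime (f a) := hf a (Finset.mem_insert_self a s)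
    obtain ⟨y, rfl⟩ := ih (fun i hi => hf i (Finset.mem_insert_of_mem hi))
      (fun i hi j hj => hna i (Finset.mem_insert_of_mem hi) j (Finset.mem_insert_of_mem hj))
      (fun i hi => hx i (Finset.mem_insert_of_mem hi))
    rcases hfa.dvd_or_dvd (hx a (Finset.mem_insert_self a s)) with h | h
    · obtain ⟨i, hi, hdi⟩ := hfa.exists_mem_finset_dvd h
      exact absurd hdi (hna a (Finset.mem_insert_self a s) i (Finset.mem_insert_of_mem hi)
        (fun e => ha (e ▸ hi)))
    · rw [mul_comm _ y]
      exact mul_dvd_mul_right h _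

/-- **Proposition 9** (Ch. 4 §2): if `f = c · ∏ fᵢ^{eᵢ}` with `c` a unit, the `fᵢ` pairwise
non-associated primes and all `eᵢ ≥ 1`, then `√⟨f⟩ = ⟨∏ fᵢ⟩`.
[cite: CoxLittleOShea2007, Ch.4 §2 Prop. 9] -/
theorem radical_span_singleton_unit_mul_prod_pow {ι : Type*} (s : Finset ι) (f : ι → R)
    (e : ι → ℕ) {c : R} (hc : IsUnit c) (hf : ∀ i ∈ s, Prime (f i))
    (hna : ∀ i ∈ s, ∀ j ∈ s, i ≠ j → ¬ f i ∣ f j) (he : ∀ i ∈ s, e i ≠ 0) :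
    (span {c * ∏ i ∈ s, f i ^ e i}).radical = span {∏ i ∈ s, f i} := by
  classical
  apply le_antisymm
  · intro x hx
    obtain ⟨n, hn⟩ := Ideal.mem_radical_iff.1 hx
    rw [Ideal.mem_span_singleton] at hn
    rw [Ideal.mem_span_singleton]
    refine prod_dvd_of_pairwise_not_dvd s f hf hna fun i hi => (hf i hi).dvd_of_dvd_pow (n := n) ?_
    refine dvd_trans (dvd_mul_of_dvd_right ?_ c) hn
    exact (dvd_pow_self (f i) (he i hi)).trans (Finset.dvd_prod_of_mem _ hi)
  · rw [Ideal.span_singleton_le_iff_mem, Ideal.mem_radical_iff]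
    refine ⟨s.sup e, Ideal.mem_span_singleton.2 ((hc.mul_left_dvd).2 ?_)⟩
    rw [← Finset.prod_pow]
    exact Finset.prod_dvd_prod_of_dvd _ _ fun i hi => pow_dvd_pow (f i) (Finset.le_sup hi)

/-- The membership form of Proposition 9: with `f` as above, `g ∈ √⟨f⟩ ↔ ∏ fᵢ ∣ g` — "`g^M` is a
multiple of `f`, hence of each irreducible factor `fᵢ`, so each `fᵢ` divides `g`".
[cite: CoxLittleOShea2007, Ch.4 §2 Prop. 9 (proof)] -/
theorem mem_radical_span_singleton_unit_mul_prod_pow_iff {ι : Type*} (s : Finset ι) (f : ι → R)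
    (e : ι → ℕ) {c : R} (hc : IsUnit c) (hf : ∀ i ∈ s, Prime (f i))
    (hna : ∀ i ∈ s, ∀ j ∈ s, i ≠ j → ¬ f i ∣ f j) (he : ∀ i ∈ s, e i ≠ 0) {g : R} :
    g ∈ (span {c * ∏ i ∈ s, f i ^ e i}).radical ↔ (∏ i ∈ s, f i) ∣ g := by
  rw [radical_span_singleton_unit_mul_prod_pow s f e hc hf hna he, Ideal.mem_span_singleton]

end CommRing

/-! ## Proposition 9 / Definition 10 via Mathlib's `UniqueFactorizationMonoid.radical`
(normalised factorial domains: `ℤ`, `k[X]`, …) -/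

section Normalized

variable {R : Type*} [CommRing R] [NormalizationMonoid R] [UniqueFactorizationMonoid R]

/-- **Proposition 9**, membership form: for `f ≠ 0`, `g ∈ √⟨f⟩ ↔ f_red ∣ g` with
`f_red = radical f` the product of the (normalised) prime factors of `f`.
[cite: CoxLittleOShea2007, Ch.4 §2 Prop. 9] -/
theorem mem_radical_span_singleton_iff_radical_dvd {a : R} (ha : a ≠ 0) {x : R} :
    x ∈ (span {a}).radical ↔ radical a ∣ x := by
  rw [← exists_dvd_pow_iff_radical_dvd ha, Ideal.mem_radical_iff]
  simp only [Ideal.mem_span_singleton]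

/-- **Proposition 9**: `√⟨f⟩ = ⟨radical f⟩ = ⟨∏ p ∈ primeFactors f, p⟩` for `f ≠ 0` (the TODO
"`Ideal.radical (Ideal.span {a}) = Ideal.span {radical a}`" of Mathlib's
`RingTheory/Radical/Basic`).
[cite: CoxLittleOShea2007, Ch.4 §2 Prop. 9] -/
theorem radical_span_singleton_eq_span_radical {a : R} (ha : a ≠ 0) :
    (span {a}).radical = span {radical a} := by
  ext x
  rw [mem_radical_span_singleton_iff_radical_dvd ha, Ideal.mem_span_singleton]

/-- **Proposition 9** in the book's notation `⟨f₁ f₂ ⋯ f_r⟩`, the `fᵢ` running over the distinct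
(normalised) prime factors of `f ≠ 0`. [cite: CoxLittleOShea2007, Ch.4 §2 Prop. 9] -/
theorem radical_span_singleton_eq_span_prod_primeFactors {a : R} (ha : a ≠ 0) :
    (span {a}).radical = span {∏ p ∈ primeFactors a, p} :=
  radical_span_singleton_eq_span_radical ha

/-- **Definition 10** ("`f_red` is only unique up to a constant factor"): `⟨g⟩ = √⟨f⟩` iff `g` is
an associate of `radical f`. [cite: CoxLittleOShea2007, Ch.4 §2 Def. 10] -/
theorem radical_span_singleton_eq_span_singleton_iff [IsDomain R] {a : R} (ha : a ≠ 0) {g : R} :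
    (span {a}).radical = span {g} ↔ Associated (radical a) g := by
  rw [radical_span_singleton_eq_span_radical ha, Ideal.span_singleton_eq_span_singleton]

/-- **Definition 10** ("`f` is reduced, or square-free, if `f_red = f`"): `radical f` is an
associate of `f ≠ 0` iff `f` is square-free. [cite: CoxLittleOShea2007, Ch.4 §2 Def. 10] -/
theorem associated_radical_iff_squarefree {a : R} (ha : a ≠ 0) :
    Associated (radical a) a ↔ Squarefree a :=
  ⟨fun h => squarefree_radical.squarefree_of_dvd h.symm.dvd,
    fun h => radical_associated (isRadical_iff_squarefree_or_zero.2 (Or.inl h)) ha⟩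

end Normalized

/-! ## Definition 10 in an arbitrary factorial domain and in `k[x₁, …, xₙ]` -/

section UFD

variable {R : Type*} [CommRing R] [UniqueFactorizationMonoid R]

/-- **Definition 10** ("reduced ⟺ square-free"): for `f ≠ 0` in a factorial domain, `⟨f⟩` is a
radical ideal iff `f` is square-free. [cite: CoxLittleOShea2007, Ch.4 §2 Def. 10] -/
theorem span_singleton_isRadical_iff_squarefree [IsDomain R] {a : R} (ha : a ≠ 0) :
    (span {a}).IsRadical ↔ Squarefree a := by
  rw [← isRadical_iff_span_singleton, isRadical_iff_squarefree_or_zero, or_iff_left ha]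

/-- **Definition 10**, existence of the reduction in any factorial domain: for `f ≠ 0` there is a
square-free `g ∣ f` with `√⟨f⟩ = ⟨g⟩` (and `f ∣ gᴺ` for some `N`).
[cite: CoxLittleOShea2007, Ch.4 §2 Def. 10] -/
theorem exists_radical_span_singleton_eq_span {a : R} (ha : a ≠ 0) :
    ∃ g : R, (span {a}).radical = span {g} ∧ g ∣ a ∧ Squarefree g ∧ ∃ N : ℕ, a ∣ g ^ N := by
  letI : NormalizationMonoid R :=
    UniqueFactorizationMonoid.strongNormalizationMonoid.toNormalizationMonoid
  exact ⟨radical a, radical_span_singleton_eq_span_radical ha, radical_dvd_self,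
    squarefree_radical, exists_dvd_radical_self_pow ha⟩

/-- Uniqueness of the reduction up to associates, in any factorial domain (indeed any
commutative ring). [cite: CoxLittleOShea2007, Ch.4 §2 Def. 10] -/
theorem associated_of_radical_span_singleton_eq {S : Type*} [CommRing S] [IsDomain S]
    {a g g' : S} (hg : (span {a}).radical = span {g}) (hg' : (span {a}).radical = span {g'}) :
    Associated g g' :=
  Ideal.span_singleton_eq_span_singleton.1 (hg.symm.trans hg')

end UFD

section MvPolynomial

variable {σ k : Type*} [Field k]

/-- **Definition 10** for `f ∈ k[x₁, …, xₙ]`, `f ≠ 0`: a reduction `f_red` exists — square-free,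
dividing `f`, with `⟨f_red⟩ = √⟨f⟩`. [cite: CoxLittleOShea2007, Ch.4 §2 Def. 10] -/
theorem mvPolynomial_exists_reduction (f : MvPolynomial σ k) (hf : f ≠ 0) :
    ∃ g : MvPolynomial σ k,
      (span {f}).radical = span {g} ∧ g ∣ f ∧ Squarefree g ∧ ∃ N : ℕ, f ∣ g ^ N :=
  exists_radical_span_singleton_eq_span hf

/-- **Definition 10** ("`f_red` is only unique up to a constant factor in `k`").
[cite: CoxLittleOShea2007, Ch.4 §2 Def. 10] -/
theorem mvPolynomial_reduction_eq_C_mul {f g g' : MvPolynomial σ k}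
    (hg : (span {f}).radical = span {g}) (hg' : (span {f}).radical = span {g'}) :
    ∃ c : k, c ≠ 0 ∧ g' = MvPolynomial.C c * g := by
  obtain ⟨u, hu⟩ := associated_of_radical_span_singleton_eq hg hg'
  obtain ⟨r, hr, hru⟩ := MvPolynomial.isUnit_iff_eq_C_of_isReduced.1 u.isUnit
  exact ⟨r, hr.ne_zero, by rw [← hu, hru, mul_comm]⟩

end MvPolynomial

end Literature.RingTheory.UniqueFactorizationDomain.PrincipalIdealRadical
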